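import Summits.AtomisticToContinuum.BoseEinsteinCondensation.Theorems.StaticResponseBound.Negative.Basic
import Literature.MathematicalPhysics.QuantumManyBody.WeightedCorrector
import Literature.MathematicalPhysics.QuantumManyBody.PeriodicBoseGasScatteringODE
import Literature.MathematicalPhysics.QuantumManyBody.PeriodicBoseGasMomentumSector

/-!
# Negative lemmas for crux `StaticResponseBound` (stmt-AtomisticToContinuum-12057) — III:
# hypothesis-mutation table for the stubs of line `uv-thomson-force-wave`

Supports (does not close) stmt-AtomisticToContinuum-12057.  Refuter (drefute) by-products for the
picked line `Cruxes/StaticResponseBound/Lines/uv-thomson-force-wave.lean` (stubs S1–S6); the line's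
one new object `forceWave` and the mutated stub statements are restated verbatim here because a
`Cruxes/…/Lines/*.lean` work file is not an importable module.  Everything is sorry-free.

* `forceWave_congr_norm` — the force-density wave `Q_Φ` depends on `Φ` only through `|Φ|`: the
  reality / positivity binders of S5 `UvForceWaveBound` cannot act through the conclusion (they only
  pin WHICH minimiser is meant); information for the lead, not a defect.
* `forceWave_zero_momentum`, `cosMean_zero_momentum`, `densityWave_zero_momentum_eq_zero`,
  `thomsonReduction_at_zero_momentum` — at `k = 0` the unit vector `p̂` is Lean-junk `0`, the force
  wave vanishes, `⟨∑ⱼcos 0⟩_Φ = N` and the centred density wave is identically `0`, so the body of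
  S4 `ThomsonReduction` holds at `k = 0` with NO hypothesis at all: `k ≠ 0` (and `0 < L`, `0 ≤ B`,
  the `H₋₁` hypothesis) are not load-bearing for S4 — contrast §B of part I for the crux itself.
* `ModulationBootstrapAnyK`, `not_modulationBootstrapAnyK` — deleting `k ≠ 0` from S3
  `ModulationBootstrap` makes it FALSE (`w = 0`, `N = 1`, `L = 1`, `k = 0`, `T₂ = 1`, `K = 0`,
  `t = −1`, `Ψ ≡ 1`): at `k = 0` the susceptibility hypothesis is satisfied by `K = 0` (the centred
  wave is `0`), while the first-order shift `t⟨∑cos 0⟩ = tN` survives.  Any proof of S3 must use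
  `k ≠ 0` (it is `E′(0) = 0`).
* `TruncationLimit`, `TruncationLimitUnguarded`, `truncationLimit_iff_unguarded` — the guard
  `E₀^per(v,N,L) ≠ ⊤` of S2 is logically removable (`(⊤).toReal = 0`); likewise nothing is lost at
  `L ≤ 0` (`truncationLimit_body_of_nonpos`: no states for `N ≥ 1`, both sides `(⊤).toReal = 0`;
  `N = 0` needs no states).  Information for the prover: these binders carry no usable content.
-/

namespace Summit.AtomisticToContinuum.BoseEinsteinCondensation.Theorems.StaticResponseBound.Negative.UvThomsonStubs

open MeasureTheory
open scoped ENNReal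
open Literature.MathematicalPhysics.QuantumManyBody.BoseGas
open Summit.AtomisticToContinuum.BoseEinsteinCondensation.Theorems.StaticResponseBound.Negative

noncomputable section

/-! ## The line's object `forceWave` (verbatim copy) and what it depends on -/

/-- The unit vector `p̂ = k/|k|` (components; junk `0` for `k = 0`). Verbatim copy of the skeleton's
`UvThomsonForceWave.khat`. [card uv-thomson-force-wave] -/
def khat (k : Fin 3 → ℤ) (i : Fin 3) : ℝ :=
  (k i : ℝ) / Real.sqrt (∑ l, (k l : ℝ) ^ 2)

/-- The force-density wave `Q_Φ = (Y·∇|Φ|²)/|Φ|²`, `Yⱼ = sin(p·xⱼ)p̂`. Verbatim copy of the skeleton's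
`UvThomsonForceWave.forceWave`. [card uv-thomson-force-wave] -/
def forceWave {N : ℕ} (L : ℝ) (k : Fin 3 → ℤ) (Φ : PeriodicTrialState N L) (X : Config N) : ℝ :=
  (∑ j : Fin N, Real.sin (2 * Real.pi / L * ∑ i, (k i : ℝ) * X j i) *
      ∑ i : Fin 3, khat k i * pderiv j i (fun Y => ‖Φ.ψ Y‖ ^ 2) X) / ‖Φ.ψ X‖ ^ 2

/-- **The force wave sees only `|Φ|`.** Two trial states with the same modulus have the same force
wave; in particular the binders `Φ.ψ X = ‖Φ.ψ X‖` and `Φ.ψ X ≠ 0` of S5 do not enter its conclusion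
(nor S4's), they only select the Perron–Frobenius representative of the ground state. [folklore] -/
theorem forceWave_congr_norm {N : ℕ} (L : ℝ) (k : Fin 3 → ℤ) (Φ Φ' : PeriodicTrialState N L)
    (h : ∀ Y, ‖Φ.ψ Y‖ = ‖Φ'.ψ Y‖) : forceWave L k Φ = forceWave L k Φ' := by
  have h2 : (fun Y => ‖Φ.ψ Y‖ ^ 2) = (fun Y => ‖Φ'.ψ Y‖ ^ 2) := by
    funext Y; rw [h Y]
  funext X
  simp only [forceWave, h2, h X]

/-- At `k = 0` the force wave vanishes identically (`p̂ = 0/0 = 0`). [folklore] -/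
theorem forceWave_zero_momentum {N : ℕ} (L : ℝ) (Φ : PeriodicTrialState N L) (X : Config N) :
    forceWave L 0 Φ X = 0 := by
  simp [forceWave, khat]

/-- At `k = 0` the "density wave" is the particle number: `⟨∑ⱼ cos 0⟩_Φ = N`. [folklore] -/
theorem cosMean_zero_momentum {N : ℕ} (L : ℝ) (Φ : PeriodicTrialState N L) : cosMean L 0 Φ = N := by
  unfold cosMean
  have : ∀ X : Config N,
      (∑ j : Fin N, Real.cos (2 * Real.pi / L * ∑ i : Fin 3, ((0 : Fin 3 → ℤ) i : ℝ) * X j i)) *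
        ‖Φ.ψ X‖ ^ 2 = (N : ℝ) * ‖Φ.ψ X‖ ^ 2 := by
    intro X
    simp
  simp_rw [this]
  rw [integral_const_mul, integral_norm_sq_eq_one, mul_one]

/-- At `k = 0` the centred density wave `∑ⱼcos(p·xⱼ) − ⟨∑cos⟩_Φ` is identically `0`. [folklore] -/
theorem densityWave_zero_momentum_eq_zero {N : ℕ} (L : ℝ) (Φ : PeriodicTrialState N L) :
    (fun X : Config N => (∑ j : Fin N, Real.cos (2 * Real.pi / L * ∑ i : Fin 3,
        ((0 : Fin 3 → ℤ) i : ℝ) * X j i)) - cosMean L 0 Φ) = 0 := by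
  funext X
  simp [cosMean_zero_momentum]

/-- **`k ≠ 0` is NOT load-bearing for S4 `ThomsonReduction`**: its body at `k = 0` holds for every
`N`, `L`, `Φ`, `B`, with the hypotheses `0 < L`, `0 ≤ B` and the `H₋₁` bound on the force wave all
dropped — both `H₋₁` norms are norms of the zero function and the right-hand side is junk
`ofReal((√N+√B)²/0) = 0`. (So the skeleton's remark "S4 uses `k ≠ 0` (division by `|p|²`)" concerns
the PROOF for `k ≠ 0`, not the statement.) [folklore] -/
theorem thomsonReduction_at_zero_momentum (N : ℕ) (L : ℝ) (Φ : PeriodicTrialState N L) (B : ℝ) :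
    hMinusOneSqW L (fun X => ‖Φ.ψ X‖)
        (fun X => (∑ j, Real.cos (2 * Real.pi / L * ∑ i, ((0 : Fin 3 → ℤ) i : ℝ) * X j i)) -
          cosMean L 0 Φ)
      ≤ ENNReal.ofReal ((Real.sqrt N + Real.sqrt B) ^ 2 / psq L 0) := by
  rw [densityWave_zero_momentum_eq_zero, hMinusOneSqW_zero]
  exact bot_le

/-! ## S3 `ModulationBootstrap` with `k ≠ 0` deleted is false -/

/-- S3 `ModulationBootstrap` of the skeleton with the binder `k ≠ 0` deleted (everything else
verbatim). -/
def ModulationBootstrapAnyK : Prop :=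
  ∀ w : ℝ → ℝ≥0∞, IsRepulsiveFiniteRange w → (∃ M : ℝ≥0∞, M ≠ ⊤ ∧ ∀ r, w r ≤ M) →
    ∀ (N : ℕ), 1 ≤ N → ∀ (L : ℝ), 0 < L → ∀ (k : Fin 3 → ℤ),
    ∀ (T₂ K : ℝ), 0 ≤ T₂ → 0 ≤ K →
    (∀ s : ℝ, s ^ 2 ≤ T₂ → ∀ Φ : PeriodicTrialState N L,
      (∀ X, Φ.ψ X = (‖Φ.ψ X‖ : ℂ)) → (∀ X, Φ.ψ X ≠ 0) → periodicEnergy w Φ ≠ ⊤ →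
      (∀ Ψ : PeriodicTrialState N L, periodicEnergy w Ψ ≠ ⊤ →
        (periodicEnergy w Φ).toReal + s * cosMean L k Φ ≤ (periodicEnergy w Ψ).toReal + s * cosMean L k Ψ) →
      hMinusOneSqW L (fun X => ‖Φ.ψ X‖)
          (fun X => (∑ j, Real.cos (2 * Real.pi / L * ∑ i, (k i : ℝ) * X j i)) - cosMean L k Φ)
        ≤ ENNReal.ofReal K) →
    ∀ t : ℝ, t ^ 2 ≤ T₂ → ∀ Ψ : PeriodicTrialState N L, periodicEnergy w Ψ ≠ ⊤ →
      (periodicGroundStateEnergy w N L).toReal - K * t ^ 2 ≤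
        (periodicEnergy w Ψ).toReal + t * cosMean L k Ψ

/-- **`k ≠ 0` is load-bearing for S3 `ModulationBootstrap`.** Witness `w = 0` (bounded by `0`),
`N = 1`, `L = 1`, `k = 0`, `T₂ = 1`, `K = 0`, `t = −1`, `Ψ ≡ 1`: the susceptibility hypothesis holds
with `K = 0` because the centred wave is the zero function (`densityWave_zero_momentum_eq_zero`,
`hMinusOneSqW_zero`), and the conclusion reads `0 − 0 ≤ 0 − 1`.  The first-order term
`t⟨∑ⱼcos(p·xⱼ)⟩ = tN` is what `k ≠ 0` kills (`E′(0) = 0`). [folklore] -/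
theorem not_modulationBootstrapAnyK : ¬ ModulationBootstrapAnyK := by
  intro h
  have hL : (0 : ℝ) < 1 := one_pos
  have key := h 0 isRepulsiveFiniteRange_zero ⟨0, ENNReal.zero_ne_top, fun _ => le_rfl⟩ 1 le_rfl 1
    hL 0 1 0 zero_le_one le_rfl
    (fun s _ Φ _ _ _ _ => by
      rw [densityWave_zero_momentum_eq_zero, hMinusOneSqW_zero]
      exact bot_le)
    (-1) (by norm_num) (PeriodicTrialState.const hL)
    (by rw [periodicEnergy_const]; exact ENNReal.zero_ne_top)
  rw [periodicGroundStateEnergy_one hL, periodicEnergy_const, cosMean_zero_momentum] at key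
  norm_num at key

/-! ## S2 `TruncationLimit`: the finite-energy guard and `0 < L` carry no content -/

/-- S2 `TruncationLimit` of the skeleton, verbatim. -/
def TruncationLimit : Prop :=
  ∀ v : ℝ → ℝ≥0∞, IsRepulsiveFiniteRange v → ∀ (N : ℕ) (L : ℝ), 0 < L →
    periodicGroundStateEnergy v N L ≠ ⊤ →
    ∀ ε : ℝ, 0 < ε → ∃ n₁ : ℕ, ∀ n : ℕ, n₁ ≤ n →
      (periodicGroundStateEnergy v N L).toReal ≤
        (periodicGroundStateEnergy (truncPotential v n) N L).toReal + ε

/-- S2 with the guard `periodicGroundStateEnergy v N L ≠ ⊤` deleted. -/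
def TruncationLimitUnguarded : Prop :=
  ∀ v : ℝ → ℝ≥0∞, IsRepulsiveFiniteRange v → ∀ (N : ℕ) (L : ℝ), 0 < L →
    ∀ ε : ℝ, 0 < ε → ∃ n₁ : ℕ, ∀ n : ℕ, n₁ ≤ n →
      (periodicGroundStateEnergy v N L).toReal ≤
        (periodicGroundStateEnergy (truncPotential v n) N L).toReal + ε

/-- **The guard of S2 is decoration**: with `E₀^per(v,N,L) = ⊤` the left-hand side is
`(⊤).toReal = 0 ≤ 0 + ε`.  (Mutation information: a proof of S2 gains nothing from the guard except
the case split it performs anyway.) [folklore] -/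
theorem truncationLimit_iff_unguarded : TruncationLimit ↔ TruncationLimitUnguarded := by
  constructor
  · intro h v hv N L hL ε hε
    rcases eq_or_ne (periodicGroundStateEnergy v N L) ⊤ with htop | hne
    · refine ⟨0, fun n _ => ?_⟩
      rw [htop, ENNReal.toReal_top]
      have : 0 ≤ (periodicGroundStateEnergy (truncPotential v n) N L).toReal := ENNReal.toReal_nonneg
      linarith
    · exact h v hv N L hL hne ε hε
  · intro h v hv N L hL _ ε hε
    exact h v hv N L hL ε hε

/-- **`0 < L` carries no content either**: for `L ≤ 0` and `N ≥ 1` there are no periodic trial states,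
so both ground-state energies are `⊤` (infimum over an empty type) and the inequality of S2 reads
`0 ≤ 0 + ε`. [folklore] -/
theorem truncationLimit_body_of_nonpos (v : ℝ → ℝ≥0∞) {N : ℕ} (hN : 0 < N) {L : ℝ} (hL : L ≤ 0)
    {ε : ℝ} (hε : 0 < ε) (n : ℕ) :
    (periodicGroundStateEnergy v N L).toReal ≤
      (periodicGroundStateEnergy (truncPotential v n) N L).toReal + ε := by
  haveI := PeriodicTrialState.isEmpty_of_nonpos hL hN
  have h1 : periodicGroundStateEnergy v N L = ⊤ := iInf_of_empty _
  have h2 : periodicGroundStateEnergy (truncPotential v n) N L = ⊤ := iInf_of_empty _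
  rw [h1, h2, ENNReal.toReal_top]
  linarith

end

end Summit.AtomisticToContinuum.BoseEinsteinCondensation.Theorems.StaticResponseBound.Negative.UvThomsonStubs
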